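import Mathlib
import Literature.MathematicalPhysics.QuantumManyBody.BoseEinsteinCondensation
import Literature.MathematicalPhysics.QuantumManyBody.BoseGasThermodynamicLimitRuelle
import Summits.AtomisticToContinuum.BoseEinsteinCondensation.Theorems.SoloBlindFragmentedStates

/-!
Solo residency `solo-AtomisticToContinuum-blind`, session 3 — families of fragmented states.

Paper: run/shared/lean/ideation/AtomisticToContinuum/solo-blind/paper/paper.md, §11.

Iterating Ruelle's merge over a finite family of pairwise `R`-separated regions `U_c` with
prescribed particle numbers `n_c` gives a legitimate Bose state whose energy is the sum of the
block energies and whose one-particle modes are all occupied by at most `max_c n_c` particles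
(`exists_mergeFamily_univ`). Specialised to the cubic cell lattice of the tree
(`subBox ℓ (ℓ+R) (digits3 m c)`, `c < m³`) inside the box `Λ_L`, `m(ℓ+R) ≤ L`: if the energy
window `E ≤ E₀(N, L) + w` is wide enough to contain the sum of the cell energies, then the
window infimum of `maxOccupation` is at most `max_c n_c` (`window_iInf_maxOccupation_le_cells`).
-/

open MeasureTheory ENNReal Filter Topology
open scoped BigOperators

open Literature.MathematicalPhysics.QuantumManyBody.BoseGas

namespace Summit.AtomisticToContinuum.BoseEinsteinCondensation.Theorems

variable {v : ℝ → ℝ≥0∞} {R : ℝ}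

section MergeFactors

variable {N₁ N₂ : ℕ} {U₁ U₂ : Set Space}

/-- At a configuration where the merged state does not vanish there is an admissible relabelling
for which both factors of the product are non-zero. -/
theorem exists_permAdm_factors_ne_zero (Ψ₁ : SupportedState N₁ U₁) (Ψ₂ : SupportedState N₂ U₂)
    (hdisj : Disjoint U₁ U₂) {X : Config (N₁ + N₂)} (hX : (Ψ₁.merge Ψ₂ hdisj).ψ X ≠ 0) :
    ∃ σ : Equiv.Perm (Fin (N₁ + N₂)), PermAdm N₁ N₂ U₁ U₂ σ X ∧
      Ψ₁.ψ (fun i => X (σ (Fin.castAdd N₂ i))) ≠ 0 ∧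
      Ψ₂.ψ (fun j => X (σ (Fin.natAdd N₁ j))) ≠ 0 := by
  have h1 : symSum Ψ₁ Ψ₂ X ≠ 0 := by
    intro h0
    apply hX
    change ((mergeScale N₁ N₂ : ℝ) : ℂ) * symSum Ψ₁ Ψ₂ X = 0
    rw [h0, mul_zero]
  obtain ⟨σ, -, hσ⟩ := Finset.exists_ne_zero_of_sum_ne_zero h1
  have hadm : PermAdm N₁ N₂ U₁ U₂ σ X := by
    by_contra hcon
    exact hσ (permProd_eq_zero_of_not_permAdm Ψ₁ Ψ₂ hcon).1
  have hprod : permProd Ψ₁ Ψ₂ σ X = Ψ₁.ψ (fun i => X (σ (Fin.castAdd N₂ i))) *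
      Ψ₂.ψ (fun j => X (σ (Fin.natAdd N₁ j))) := rfl
  rw [hprod] at hσ
  exact ⟨σ, hadm, (mul_ne_zero_iff.1 hσ).1, (mul_ne_zero_iff.1 hσ).2⟩

/-- Reindex a one-particle sum through a relabelling and split it into the two blocks. -/
theorem sum_particles_eq_sum_blocks (f : Space → ℝ≥0∞) (σ : Equiv.Perm (Fin (N₁ + N₂)))
    (X : Config (N₁ + N₂)) :
    ∑ p, f (X p) = ∑ i : Fin N₁, f (X (σ (Fin.castAdd N₂ i))) +
      ∑ j : Fin N₂, f (X (σ (Fin.natAdd N₁ j))) := by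
  rw [← Equiv.sum_comp σ (fun p => f (X p)), Fin.sum_univ_add]

end MergeFactors

section Family

variable {ι : Type*} [DecidableEq ι] (U : ι → Set Space) (n : ι → ℕ)
  (Φ : ∀ c, SupportedState (n c) (U c))

/-- The vacuum has zero energy. -/
theorem soloFrag_rawEnergy_vacuum (v : ℝ → ℝ≥0∞) (V : Set Space) :
    rawEnergy v (SupportedState.vacuum V).ψ = 0 := by
  refine (lintegral_congr fun X => ?_).trans lintegral_zero
  simp [kineticDensity, interaction, SupportedState.vacuum]

/-- **Iterated merge with block counts.** For a finite family of pairwise `R`-separated regions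
`U_c` carrying states `Φ_c` of `n_c` bosons each, there is a state of `∑ n_c` bosons supported in
`⋃ U_c` whose energy is `∑ E(Φ_c)` and which lives on configurations with exactly `n_c`
particles in `U_c` for every `c`. -/
theorem exists_mergeFamily (hv : Measurable v) (hv0 : ∀ r, R < r → v r = 0) (hR : 0 ≤ R)
    (T : Finset ι)
    (hsep : ∀ c ∈ T, ∀ c' ∈ T, c ≠ c' → ∀ x ∈ U c, ∀ y ∈ U c', R < dist x y) :
    ∃ N : ℕ, N = ∑ c ∈ T, n c ∧ ∃ Ψ : SupportedState N (⋃ c ∈ T, U c),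
      rawEnergy v Ψ.ψ = ∑ c ∈ T, rawEnergy v (Φ c).ψ ∧
      ∀ X, Ψ.ψ X ≠ 0 → ∀ c ∈ T,
        ∑ p : Fin N, (U c).indicator (fun _ => (1 : ℝ≥0∞)) (X p) = n c := by
  induction T using Finset.induction_on with
  | empty =>
    exact ⟨0, by simp, SupportedState.vacuum _, by simp [soloFrag_rawEnergy_vacuum],
      fun X _ c hc => absurd hc (by simp)⟩
  | insert c T hc ih =>
    have hsepT : ∀ c₁ ∈ T, ∀ c₂ ∈ T, c₁ ≠ c₂ → ∀ x ∈ U c₁, ∀ y ∈ U c₂, R < dist x y :=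
      fun c₁ h₁ c₂ h₂ => hsep c₁ (Finset.mem_insert_of_mem h₁) c₂ (Finset.mem_insert_of_mem h₂)
    obtain ⟨NT, hNT, ΨT, hE, hcnt⟩ := ih hsepT
    have hsep' : ∀ x ∈ U c, ∀ y ∈ ⋃ c' ∈ T, U c', R < dist x y := by
      intro x hx y hy
      simp only [Set.mem_iUnion] at hy
      obtain ⟨c', hc', hy⟩ := hy
      exact hsep c (Finset.mem_insert_self c T) c' (Finset.mem_insert_of_mem hc')
        (fun h => hc (h ▸ hc')) x hx y hy
    have hdisj : Disjoint (U c) (⋃ c' ∈ T, U c') := by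
      rw [Set.disjoint_left]
      intro x hx hx'
      have := hsep' x hx x hx'
      rw [dist_self] at this
      exact absurd this (not_lt.2 hR)
    refine ⟨n c + NT, by rw [Finset.sum_insert hc, hNT],
      ((Φ c).merge ΨT hdisj).mono (Finset.set_biUnion_insert c T U).symm.subset, ?_, ?_⟩
    · change rawEnergy v ((Φ c).merge ΨT hdisj).ψ = _
      rw [rawEnergy_merge (Φ c) ΨT hdisj hv hv0 hsep', hE, Finset.sum_insert hc]
    · intro X hX c₁ hc₁
      change ((Φ c).merge ΨT hdisj).ψ X ≠ 0 at hX
      obtain ⟨σ, hσ, -, h2⟩ := exists_permAdm_factors_ne_zero (Φ c) ΨT hdisj hX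
      rw [sum_particles_eq_sum_blocks ((U c₁).indicator fun _ => (1 : ℝ≥0∞)) σ X]
      rcases Finset.mem_insert.1 hc₁ with rfl | hc₁T
      · rw [Finset.sum_congr rfl fun i _ => Set.indicator_of_mem (hσ.1 i) _,
          Finset.sum_congr rfl fun j _ =>
            Set.indicator_of_notMem (Set.disjoint_right.1 hdisj (hσ.2 j)) _]
        simp
      · have hc₁c : c₁ ≠ c := fun h => hc (h ▸ hc₁T)
        have hnot : ∀ i : Fin (n c), X (σ (Fin.castAdd NT i)) ∉ U c₁ := by
          intro i hi
          have := hsep c (Finset.mem_insert_self c T) c₁ hc₁ hc₁c.symm _ (hσ.1 i) _ hi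
          rw [dist_self] at this
          exact absurd this (not_lt.2 hR)
        rw [Finset.sum_congr rfl fun i _ => Set.indicator_of_notMem (hnot i) _]
        simp only [Finset.sum_const_zero, zero_add]
        exact hcnt _ h2 c₁ hc₁T

end Family

section Univ

variable {M : ℕ} (U : Fin M → Set Space) (n : Fin M → ℕ)
  (Φ : ∀ c, SupportedState (n c) (U c))

/-- **A merged family is fragmented.** Over the whole index set: a state of `∑ n_c` bosons in
`⋃ U_c` with energy `∑ E(Φ_c)` and every one-particle mode occupied by at most `max_c n_c`
particles. -/
theorem exists_mergeFamily_univ (hv : Measurable v) (hv0 : ∀ r, R < r → v r = 0) (hR : 0 ≤ R)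
    (hsep : ∀ c c', c ≠ c' → ∀ x ∈ U c, ∀ y ∈ U c', R < dist x y)
    (hUm : ∀ c, MeasurableSet (U c)) {K : ℕ} (hK : ∀ c, n c ≤ K) :
    ∃ Ψ : SupportedState (∑ c, n c) (⋃ c, U c),
      rawEnergy v Ψ.ψ = ∑ c, rawEnergy v (Φ c).ψ ∧
      maxOccupation (∑ c, n c) Ψ.ψ ≤ (K : ℝ≥0∞) := by
  obtain ⟨N, hN, Ψ, hE, hcnt⟩ :=
    exists_mergeFamily U n Φ hv hv0 hR Finset.univ (fun c _ c' _ h => hsep c c' h)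
  subst hN
  have hUU : (⋃ c ∈ (Finset.univ : Finset (Fin M)), U c) = ⋃ c, U c := by simp
  refine ⟨Ψ.mono hUU.le, hE, iSup₂_le fun φ hφ => ?_⟩
  change occupation _ φ Ψ.ψ ≤ _
  refine occupation_le_of_blockCounts' Ψ.contDiff.continuous Ψ.symm Ψ.norm_eq U hUm ?_ n
    (fun X hX c => hcnt X hX c (Finset.mem_univ c)) ?_ hφ.1 hφ.2 hK
  · intro j l hjl x hxj hxl
    have := hsep j l hjl x hxj x hxl
    rw [dist_self] at this
    exact absurd this (not_lt.2 hR)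
  · intro X hX p
    by_contra hcon
    push Not at hcon
    apply hX
    refine Ψ.eq_zero X ⟨p, ?_⟩
    simp only [Finset.mem_univ, Set.iUnion_true, Set.mem_iUnion, not_exists]
    exact hcon

end Univ

section Cells

variable {ℓ L : ℝ}

/-- **Energy windows containing the cell sum certify at most the largest cell.** Fill `Λ_L`,
`m(ℓ+R) ≤ L`, with the `m³` cells `subBox ℓ (ℓ+R) (digits3 m c)` holding `n_c` bosons each,
`∑ n_c = N`. If `E₀^D(n_c, ℓ) < e_c` for every cell and `∑ e_c ≤ E₀^D(N, L) + w`, then the window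
`E ≤ E₀^D(N, L) + w` contains a state all of whose one-particle modes carry at most `max n_c`
particles: `⨅_{window} maxOccupation ≤ K` whenever `n_c ≤ K` for all `c`. -/
theorem window_iInf_maxOccupation_le_cells (hv : Measurable v) (hv0 : ∀ r, R < r → v r = 0)
    (hR : 0 ≤ R) (hℓ : 0 < ℓ) {m : ℕ} (hL : m * (ℓ + R) ≤ L) (n : Fin (m ^ 3) → ℕ) {N : ℕ}
    (hN : ∑ c, n c = N) (e : Fin (m ^ 3) → ℝ≥0∞)
    (he : ∀ c, groundStateEnergy v (n c) ℓ < e c) {w : ℝ≥0∞}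
    (hw : ∑ c, e c ≤ groundStateEnergy v N L + w) {K : ℕ} (hK : ∀ c, n c ≤ K) :
    ⨅ (Θ : TrialState N L) (_ : energy v Θ ≤ groundStateEnergy v N L + w),
      maxOccupation N Θ.ψ ≤ (K : ℝ≥0∞) := by
  subst hN
  have hex : ∀ c, ∃ Φc : TrialState (n c) ℓ, energy v Φc < e c := fun c => by
    have h := he c
    unfold groundStateEnergy at h
    exact iInf_lt_iff.1 h
  choose Φ0 hΦ0 using hex
  let a : Fin (m ^ 3) → Space := fun c => WithLp.toLp 2 fun k => (ℓ + R) * (digits3 m c k : ℝ)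
  let Φ : ∀ c, SupportedState (n c) (subBox ℓ (ℓ + R) (digits3 m c)) :=
    fun c => ((Φ0 c).toSupported).translate (a c)
  obtain ⟨Ψ, hE, hocc⟩ := exists_mergeFamily_univ (fun c => subBox ℓ (ℓ + R) (digits3 m c)) n Φ
    hv hv0 hR
    (fun c c' hne x hx y hy => subBox_separated hR (fun h => hne (digits3_injective m h)) hx hy)
    (fun c => (measurableSet_box ℓ).preimage (measurable_id.sub_const _)) hK
  have hsub : (⋃ c, subBox ℓ (ℓ + R) (digits3 m c)) ⊆ box L :=
    Set.iUnion_subset fun c => subBox_subset_box hR hℓ hL (digits3_lt m c)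
  have hΘle : energy v (Ψ.mono hsub).toTrialState ≤ groundStateEnergy v (∑ c, n c) L + w := by
    change rawEnergy v Ψ.ψ ≤ _
    rw [hE]
    refine le_trans (Finset.sum_le_sum fun c _ => ?_) hw
    change rawEnergy v (((Φ0 c).toSupported).translate (a c)).ψ ≤ e c
    rw [rawEnergy_translate]
    exact (hΦ0 c).le
  exact (iInf₂_le (Ψ.mono hsub).toTrialState hΘle).trans hocc

end Cells

end Summit.AtomisticToContinuum.BoseEinsteinCondensation.Theorems
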